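import Literature.Analysis.FluidPDE.ElgindiCommutatorCalculus
import Literature.Analysis.FluidPDE.ElgindiMomentCalculus
import Literature.Analysis.FluidPDE.ElgindiTrigCoefficients
import HarnessLib

/-!
# The non-local part `𝓚 = 𝓛_Γ^T − 𝓛₀` of Elgindi's operator under `D_θ^iD_z^j`
([Elgindi2021] §6.3 / [ElgindiGhoulMasmoudi2021] §3.1)

Topic `Literature/Analysis/FluidPDE`. Support file (two definitions with bodies, everything proved;
no named facts) on the proof path of the named fact
`Literature.Analysis.FluidPDE.Elgindi.ElgindiGhoulMasmoudi2021_stabilityCore`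
(`ElgindiStabilityDecomposition.lean`). T. M. Elgindi, Ann. of Math. 194 (2021) =
arXiv:1904.04795, §6.3 proof of Proposition 6.13, and Elgindi–Ghoul–Masmoudi 2021,
arXiv:1910.14071, §3.1 proof of Proposition 3.2:

> "`D_θ^k𝓛^T_{F_*}(f) = 𝓛(D_θ^kf) + D_θ^kΓ(−(2y/(c(1+y)²))L₁₂(f) +
> (1/c)(2y²/(1+y)³)L₁₂((3/(1+y))sin(2θ)∂_θf)(0)) − (3/(1+y))sin(2θ)∂_θD_θ^kf`. … Now we apply
> `D_y^{j+1}` to the above expression."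

The non-local part of `𝓛_Γ^T` is the sum of two separable products,
`𝓚f = S₁(z)Γ(θ) + S₂(z)Γ(θ)`, `S₁ = −(2/c)(z/(1+z)²)L₁₂(f)`, `S₂ = (2ℓ₀(f)/c)(z²/(1+z)³)`,
`ℓ₀(f) = L₁₂((3/(1+z))D_θf)(0)` (`nlRad₁`, `nlRad₂`, `opLΓT_eq_opLT0_add_tensor`), so that on the open
strip `D_θ^iD_z^j(𝓛_Γ^Tf) = D_θ^iD_z^j(𝓛₀f) + (D_z^jS₁)(D_θ^iΓ) + (D_z^jS₂)(D_θ^iΓ)`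
(`iterate_Dθ_Dz_opLΓT`), with the radial derivatives given by the one-variable Leibniz rule and
`D_z^{b+1}L₁₂(f) = −(K, D_z^bf)_θ` (`iterate_Dz₁_nlRad₁`, `iterate_Dz₁_nlRad₂`), and the pointwise
bounds `|D_z^lS₁| ≤ C(z/(1+z)²)Σ_{b≤l}|D_z^{l−b}L₁₂(f)|`, `|D_z^lS₂| ≤ C|ℓ₀(f)|z²/(1+z)³` with `C = C(l)`
uniform in `0 ≤ α ≤ 1/200`.
-/

noncomputable section

open MeasureTheory Set Function Real Filter Finset
open _root_.Topology

namespace Literature.Analysis.FluidPDE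

namespace Elgindi

/-! ### The two radial factors of the non-local part -/

/-- The radial factor of the `L₁₂`-term of `𝓛_Γ^T`: `S₁(z) = −(2/c)·(z/(1+z)²)·L₁₂(f)(z)`. [cite: Elgindi2021, §6 Definition 6.1 (p. 16 of arXiv:1904.04795)] -/
def nlRad₁ (α : ℝ) (f : ℝ → ℝ → ℝ) (z : ℝ) : ℝ :=
  -(2 / profileConst α) * (z / (1 + z) ^ 2 * L12 f z)

/-- The radial factor of the projector term of `𝓛_Γ^T`: `S₂(z) = (2ℓ₀(f)/c)·z²/(1+z)³`,
`ℓ₀(f) = L₁₂((3/(1+z))D_θf)(0)`. [cite: Elgindi2021, §6 Definitions 6.1–6.2 (p. 16 of arXiv:1904.04795)] -/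
def nlRad₂ (α : ℝ) (f : ℝ → ℝ → ℝ) (z : ℝ) : ℝ :=
  2 * L12 (fun z θ => 3 / (1 + z) * Dθ f z θ) 0 / profileConst α * (z ^ 2 / (1 + z) ^ 3)

/-- Unfolding `nlRad₁`. [folklore] -/
theorem nlRad₁_apply (α : ℝ) (f : ℝ → ℝ → ℝ) (z : ℝ) :
    nlRad₁ α f z = -(2 / profileConst α) * (z / (1 + z) ^ 2 * L12 f z) := rfl

/-- Unfolding `nlRad₂`. [folklore] -/
theorem nlRad₂_apply (α : ℝ) (f : ℝ → ℝ → ℝ) (z : ℝ) :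
    nlRad₂ α f z = 2 * L12 (fun z θ => 3 / (1 + z) * Dθ f z θ) 0 / profileConst α * (z ^ 2 / (1 + z) ^ 3) := rfl

/-- **`𝓛_Γ^T = 𝓛₀ + S₁⊗Γ + S₂⊗Γ`** as functions. [cite: Elgindi2021, §6 Definitions 6.1–6.2 (p. 16 of arXiv:1904.04795)] -/
theorem opLΓT_eq_opLT0_add_tensor (α : ℝ) (f : ℝ → ℝ → ℝ) :
    opLΓT α f = opLT0 f + tensor (nlRad₁ α f) (angularWeight α) + tensor (nlRad₂ α f) (angularWeight α) := by
  funext z θ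
  simp only [Pi.add_apply, tensor, nlRad₁, nlRad₂, opLΓT_eq_opLT0, projKernel, div_eq_mul_inv, mul_inv]
  ring

/-! ### Regularity on the strip -/

/-- `Γ_α` is smooth on the open quarter. [folklore] -/
theorem contDiffOn_angularWeight (α : ℝ) (n : WithTop ℕ∞) : ContDiffOn ℝ n (angularWeight α) (Ioo 0 (π / 2)) := by
  unfold angularWeight
  refine ContDiffOn.rpow_const_of_ne (by fun_prop) fun θ hθ => ?_
  have hs : 0 < Real.sin θ := Real.sin_pos_of_pos_of_lt_pi hθ.1 (by linarith [hθ.2, Real.pi_pos])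
  have hc : 0 < Real.cos θ := Real.cos_pos_of_mem_Ioo ⟨by linarith [hθ.1, Real.pi_pos], hθ.2⟩
  positivity

/-- A separable product of `C^n(0,∞)` and `C^n(0,π/2)` factors is `C^n(strip)`. [folklore] -/
theorem contDiffOn_tensor {R G : ℝ → ℝ} {n : WithTop ℕ∞} (hR : ContDiffOn ℝ n R (Ioi 0))
    (hG : ContDiffOn ℝ n G (Ioo 0 (π / 2))) : ContDiffOn ℝ n (uncurry (tensor R G)) strip := by
  have h := (hR.comp contDiffOn_fst fun p (hp : p ∈ strip) => hp.1).mul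
    (hG.comp contDiffOn_snd fun p (hp : p ∈ strip) => hp.2)
  exact h.congr fun p _ => rfl

/-- `S₁ ∈ Cⁿ(0,∞)` for `f ∈ Cⁿ` compactly supported inside the open strip. [folklore] -/
theorem contDiffOn_nlRad₁ (α : ℝ) {f : ℝ → ℝ → ℝ} {n : ℕ} (hf : ContDiff ℝ n (uncurry f))
    (hs : HasCompactSupport (uncurry f)) (hsub : tsupport (uncurry f) ⊆ strip) :
    ContDiffOn ℝ n (nlRad₁ α f) (Ioi 0) := by
  have h1 : ContDiffOn ℝ n (fun z : ℝ => z / (1 + z) ^ 2) (Ioi 0) :=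
    (contDiffOn_coeffs n).2.1.mono fun z hz => by have : (0 : ℝ) < z := hz; show (-1 : ℝ) < z; linarith
  have h2 : ContDiffOn ℝ n (L12 f) (Ioi 0) := (contDiff_L12 hf hs hsub).contDiffOn
  exact (contDiffOn_const.mul (h1.mul h2)).congr fun z _ => rfl

/-- `S₂ ∈ Cⁿ(0,∞)`. [folklore] -/
theorem contDiffOn_nlRad₂ (α : ℝ) (f : ℝ → ℝ → ℝ) (n : WithTop ℕ∞) : ContDiffOn ℝ n (nlRad₂ α f) (Ioi 0) := by
  have h1 : ContDiffOn ℝ n (fun z : ℝ => z ^ 2 / (1 + z) ^ 3) (Ioi 0) :=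
    (contDiffOn_coeffs n).2.2.mono fun z hz => by have : (0 : ℝ) < z := hz; show (-1 : ℝ) < z; linarith
  exact (contDiffOn_const.mul h1).congr fun z _ => rfl

/-! ### `D_θ^iD_z^j` of `𝓛_Γ^T`: local part plus two separable products -/

/-- **`D_θ^iD_z^j(𝓛_Γ^Tf) = D_θ^iD_z^j(𝓛₀f) + (D_z^jS₁)(D_θ^iΓ) + (D_z^jS₂)(D_θ^iΓ)` on the open strip**
for `f ∈ C^N` compactly supported inside the open strip, `i + j + 1 ≤ N`. [cite: Elgindi2021, §6.3 proof of Proposition 6.13 (p. 18 of arXiv:1904.04795); ElgindiGhoulMasmoudi2021, §3.1 proof of Proposition 3.2 (p. 10 of arXiv:1910.14071)] -/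
theorem iterate_Dθ_Dz_opLΓT (α : ℝ) {f : ℝ → ℝ → ℝ} {N : ℕ} (hf : ContDiff ℝ N (uncurry f))
    (hs : HasCompactSupport (uncurry f)) (hsub : tsupport (uncurry f) ⊆ strip) {i j : ℕ} (h : i + j + 1 ≤ N) :
    ∀ p ∈ strip, Dθ^[i] (Dz^[j] (opLΓT α f)) p.1 p.2 =
      Dθ^[i] (Dz^[j] (opLT0 f)) p.1 p.2
        + Dz₁^[j] (nlRad₁ α f) p.1 * Dθ₁^[i] (angularWeight α) p.2
        + Dz₁^[j] (nlRad₂ α f) p.1 * Dθ₁^[i] (angularWeight α) p.2 := by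
  intro p hp
  have hfN : ContDiffOn ℝ (((N - 1 : ℕ) : WithTop ℕ∞) + 1) (uncurry f) strip :=
    hf.contDiffOn.of_le (by exact_mod_cast (by omega : N - 1 + 1 ≤ N))
  have h0 : ContDiffOn ℝ ((N - 1 : ℕ) : WithTop ℕ∞) (uncurry (opLT0 f)) strip := contDiffOn_opLT0 hfN
  have h1 : ContDiffOn ℝ ((N - 1 : ℕ) : WithTop ℕ∞) (uncurry (tensor (nlRad₁ α f) (angularWeight α))) strip :=
    contDiffOn_tensor ((contDiffOn_nlRad₁ α hf hs hsub).of_le (by exact_mod_cast Nat.sub_le N 1))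
      (contDiffOn_angularWeight α _)
  have h2 : ContDiffOn ℝ ((N - 1 : ℕ) : WithTop ℕ∞) (uncurry (tensor (nlRad₂ α f) (angularWeight α))) strip :=
    contDiffOn_tensor (contDiffOn_nlRad₂ α f _) (contDiffOn_angularWeight α _)
  have hij : i + j ≤ N - 1 := by omega
  rw [opLΓT_eq_opLT0_add_tensor, iterate_Dθ_Dz_add (h0.add h1) h2 hij p hp, iterate_Dθ_Dz_add h0 h1 hij p hp,
    iterate_Dθ_Dz_tensor, iterate_Dθ_Dz_tensor]
  rfl

/-! ### The radial derivatives of the two factors -/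

/-- `Dz₁` of a constant multiple. [folklore] -/
theorem Dz₁_const_mul (a : ℝ) (g : ℝ → ℝ) : Dz₁ (fun z => a * g z) = fun z => a * Dz₁ g z := by
  funext z
  simp only [Dz₁_apply, deriv_const_mul_field]
  ring

/-- Iterates of `Dz₁` of a constant multiple. [folklore] -/
theorem iterate_Dz₁_const_mul (a : ℝ) (g : ℝ → ℝ) (m : ℕ) :
    Dz₁^[m] (fun z => a * g z) = fun z => a * Dz₁^[m] g z := by
  induction m generalizing g with
  | zero => rfl
  | succ m ih => rw [Function.iterate_succ_apply, Function.iterate_succ_apply, Dz₁_const_mul, ih]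

/-- **`D_z^lS₁` by Leibniz**: on `z > 0`,
`D_z^lS₁ = −(2/c)Σ_{b≤l} C(l,b)·D_z^b(z/(1+z)²)·D_z^{l−b}L₁₂(f)` (`f ∈ C^N`, `l ≤ N`). [cite: ElgindiGhoulMasmoudi2021, §3.1 proof of Proposition 3.2 (p. 10 of arXiv:1910.14071)] -/
theorem iterate_Dz₁_nlRad₁ (α : ℝ) {f : ℝ → ℝ → ℝ} {N : ℕ} (hf : ContDiff ℝ N (uncurry f))
    (hs : HasCompactSupport (uncurry f)) (hsub : tsupport (uncurry f) ⊆ strip) {l : ℕ} (hl : l ≤ N) :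
    ∀ z ∈ Ioi (0 : ℝ), Dz₁^[l] (nlRad₁ α f) z =
      -(2 / profileConst α) * ∑ b ∈ range (l + 1), (l.choose b : ℝ) *
        (Dz₁^[b] (fun z : ℝ => z / (1 + z) ^ 2) z * Dz₁^[l - b] (L12 f) z) := by
  intro z hz
  have e : nlRad₁ α f = fun z => -(2 / profileConst α) * ((fun z : ℝ => z / (1 + z) ^ 2) z * L12 f z) := rfl
  have h1 : ContDiffOn ℝ N (fun z : ℝ => z / (1 + z) ^ 2) (Ioi 0) :=
    (contDiffOn_coeffs N).2.1.mono fun z hz => by have : (0 : ℝ) < z := hz; show (-1 : ℝ) < z; linarith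
  have h2 : ContDiffOn ℝ N (L12 f) (Ioi 0) := (contDiff_L12 hf hs hsub).contDiffOn
  rw [e, iterate_Dz₁_const_mul]
  show -(2 / profileConst α) * Dz₁^[l] (fun z => (fun z : ℝ => z / (1 + z) ^ 2) z * L12 f z) z = _
  rw [iterate_Dz₁_mul_Ioi h1 h2 hl z hz]

/-- **`D_z^lS₂ = (2ℓ₀/c)·D_z^l(z²/(1+z)³)`**. [folklore] -/
theorem iterate_Dz₁_nlRad₂ (α : ℝ) (f : ℝ → ℝ → ℝ) (l : ℕ) :
    Dz₁^[l] (nlRad₂ α f) = fun z =>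
      2 * L12 (fun z θ => 3 / (1 + z) * Dθ f z θ) 0 / profileConst α * Dz₁^[l] (fun z : ℝ => z ^ 2 / (1 + z) ^ 3) z := by
  have e : nlRad₂ α f = fun z =>
      2 * L12 (fun z θ => 3 / (1 + z) * Dθ f z θ) 0 / profileConst α * (fun z : ℝ => z ^ 2 / (1 + z) ^ 3) z := rfl
  rw [e, iterate_Dz₁_const_mul]

/-- The radial derivatives of `L₁₂(f)`: `D_z^0L₁₂(f) = L₁₂(f)` and `D_z^{b+1}L₁₂(f) = −(K, D_z^bf)_θ`,
as a uniform statement in `m`. [folklore] -/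
theorem abs_iterate_Dz₁_L12_eq {f : ℝ → ℝ → ℝ} {N : ℕ} (hf : ContDiff ℝ N (uncurry f))
    (hs : HasCompactSupport (uncurry f)) (hsub : tsupport (uncurry f) ⊆ strip) {m : ℕ} (hm : m ≤ N) (z : ℝ) :
    |Dz₁^[m] (L12 f) z| = if m = 0 then |L12 f z| else |kMoment (Dz^[m - 1] f) z| := by
  cases m with
  | zero => simp
  | succ m =>
    have hfm : ContDiff ℝ m (uncurry f) := hf.of_le (by exact_mod_cast (by omega : m ≤ N))
    rw [iterate_Dz₁_L12 hfm hs hsub z]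
    simp [abs_neg]

/-! ### Pointwise bounds, uniform in `0 ≤ α ≤ 1/200` -/

/-- **`|D_z^lS₁(z)| ≤ C_l·(z/(1+z)²)·Σ_{b≤l}|D_z^{l−b}L₁₂(f)(z)|`** on `z > 0`, with `C_l` independent
of `α ∈ [0, 1/200]` (`c ≥ 49/50`) and of `f`. [cite: ElgindiGhoulMasmoudi2021, §3.1 proof of Proposition 3.2 (p. 10 of arXiv:1910.14071)] -/
theorem exists_abs_iterate_Dz₁_nlRad₁_le (l : ℕ) : ∃ C, 0 ≤ C ∧ ∀ α : ℝ, 0 ≤ α → α ≤ 1 / 200 →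
    ∀ (f : ℝ → ℝ → ℝ) (N : ℕ), ContDiff ℝ N (uncurry f) → HasCompactSupport (uncurry f) →
    tsupport (uncurry f) ⊆ strip → l ≤ N → ∀ z : ℝ, 0 < z →
      |Dz₁^[l] (nlRad₁ α f) z| ≤ C * (z / (1 + z) ^ 2) * ∑ b ∈ range (l + 1), |Dz₁^[l - b] (L12 f) z| := by
  -- a common bound for the `D_z`-derivatives of `z/(1+z)²` up to order `l`
  have hK : ∃ K, 0 ≤ K ∧ ∀ b ≤ l, ∀ z : ℝ, 0 ≤ z → |Dz₁^[b] (fun z : ℝ => z / (1 + z) ^ 2) z| ≤ K * (z / (1 + z) ^ 2) := by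
    induction l with
    | zero =>
      obtain ⟨K, hK0, hK⟩ := exists_abs_iterate_Dz₁_div_one_add_sq_le 0
      exact ⟨K, hK0, fun b hb z hz => by rw [Nat.le_zero.1 hb]; exact hK z hz⟩
    | succ l ih =>
      obtain ⟨K₁, hK₁0, hK₁⟩ := ih
      obtain ⟨K₂, hK₂0, hK₂⟩ := exists_abs_iterate_Dz₁_div_one_add_sq_le (l + 1)
      refine ⟨max K₁ K₂, le_max_of_le_left hK₁0, fun b hb z hz => ?_⟩
      have hρ : 0 ≤ z / (1 + z) ^ 2 := by positivity
      rcases Nat.lt_or_ge b (l + 1) with hbl | hbl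
      · exact (hK₁ b (by omega) z hz).trans (mul_le_mul_of_nonneg_right (le_max_left _ _) hρ)
      · rw [le_antisymm hb hbl]
        exact (hK₂ z hz).trans (mul_le_mul_of_nonneg_right (le_max_right _ _) hρ)
  obtain ⟨K, hK0, hK⟩ := hK
  refine ⟨(2 / (49 / 50)) * (K * ∑ b ∈ range (l + 1), (l.choose b : ℝ)), by positivity, ?_⟩
  intro α hα hα' f N hf hs hsub hl z hz
  have hcpos : 0 < profileConst α := profileConst_pos hα
  have hc49 : (49 / 50 : ℝ) ≤ profileConst α := profileConst_ge hα hα'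
  have hρ : 0 ≤ z / (1 + z) ^ 2 := by positivity
  rw [iterate_Dz₁_nlRad₁ α hf hs hsub hl z hz, abs_mul]
  have h2c : |-(2 / profileConst α)| ≤ 2 / (49 / 50) := by
    rw [abs_neg, abs_of_pos (by positivity)]
    exact div_le_div_of_nonneg_left (by norm_num) (by norm_num) hc49
  have hsum : |∑ b ∈ range (l + 1), (l.choose b : ℝ) * (Dz₁^[b] (fun z : ℝ => z / (1 + z) ^ 2) z * Dz₁^[l - b] (L12 f) z)| ≤
      K * (z / (1 + z) ^ 2) * ((∑ b ∈ range (l + 1), (l.choose b : ℝ)) * ∑ b ∈ range (l + 1), |Dz₁^[l - b] (L12 f) z|) := by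
    refine (Finset.abs_sum_le_sum_abs _ _).trans ?_
    have hterm : ∀ b ∈ range (l + 1), |(l.choose b : ℝ) * (Dz₁^[b] (fun z : ℝ => z / (1 + z) ^ 2) z * Dz₁^[l - b] (L12 f) z)| ≤
        K * (z / (1 + z) ^ 2) * ((l.choose b : ℝ) * |Dz₁^[l - b] (L12 f) z|) := by
      intro b hb
      have hb' : b ≤ l := Nat.lt_succ_iff.mp (mem_range.mp hb)
      rw [abs_mul, abs_mul, Nat.abs_cast]
      have h1 := hK b hb' z hz.le
      have h3 : 0 ≤ |Dz₁^[l - b] (L12 f) z| := abs_nonneg _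
      calc (l.choose b : ℝ) * (|Dz₁^[b] (fun z : ℝ => z / (1 + z) ^ 2) z| * |Dz₁^[l - b] (L12 f) z|)
          ≤ (l.choose b : ℝ) * (K * (z / (1 + z) ^ 2) * |Dz₁^[l - b] (L12 f) z|) := by gcongr
        _ = K * (z / (1 + z) ^ 2) * ((l.choose b : ℝ) * |Dz₁^[l - b] (L12 f) z|) := by ring
    refine (Finset.sum_le_sum hterm).trans ?_
    rw [← Finset.mul_sum]
    refine mul_le_mul_of_nonneg_left ?_ (by positivity)
    -- `Σ c_b x_b ≤ (Σ c_b)(Σ x_b)` for nonnegative terms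
    rw [Finset.sum_mul]
    refine Finset.sum_le_sum fun b hb => ?_
    refine mul_le_mul_of_nonneg_left ?_ (Nat.cast_nonneg _)
    exact Finset.single_le_sum (f := fun b => |Dz₁^[l - b] (L12 f) z|) (fun _ _ => abs_nonneg _) hb
  calc |-(2 / profileConst α)| * |∑ b ∈ range (l + 1), (l.choose b : ℝ) *
        (Dz₁^[b] (fun z : ℝ => z / (1 + z) ^ 2) z * Dz₁^[l - b] (L12 f) z)|
      ≤ (2 / (49 / 50)) * (K * (z / (1 + z) ^ 2) * ((∑ b ∈ range (l + 1), (l.choose b : ℝ)) *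
          ∑ b ∈ range (l + 1), |Dz₁^[l - b] (L12 f) z|)) :=
        mul_le_mul h2c hsum (abs_nonneg _) (by positivity)
    _ = (2 / (49 / 50)) * (K * ∑ b ∈ range (l + 1), (l.choose b : ℝ)) * (z / (1 + z) ^ 2) *
          ∑ b ∈ range (l + 1), |Dz₁^[l - b] (L12 f) z| := by ring

/-- **`|D_z^lS₂(z)| ≤ C_l·|ℓ₀(f)|·z²/(1+z)³`** on `z ≥ 0`, with `C_l` independent of `α ∈ [0, 1/200]`
and of `f`. [folklore] -/
theorem exists_abs_iterate_Dz₁_nlRad₂_le (l : ℕ) : ∃ C, 0 ≤ C ∧ ∀ α : ℝ, 0 ≤ α → α ≤ 1 / 200 →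
    ∀ (f : ℝ → ℝ → ℝ) (z : ℝ), 0 ≤ z →
      |Dz₁^[l] (nlRad₂ α f) z| ≤ C * |L12 (fun z θ => 3 / (1 + z) * Dθ f z θ) 0| * (z ^ 2 / (1 + z) ^ 3) := by
  obtain ⟨K, hK0, hK⟩ := exists_abs_iterate_Dz₁_sq_div_one_add_cube_le l
  refine ⟨2 / (49 / 50) * K, by positivity, fun α hα hα' f z hz => ?_⟩
  have hcpos : 0 < profileConst α := profileConst_pos hα
  have hc49 : (49 / 50 : ℝ) ≤ profileConst α := profileConst_ge hα hα'
  rw [iterate_Dz₁_nlRad₂]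
  show |2 * L12 (fun z θ => 3 / (1 + z) * Dθ f z θ) 0 / profileConst α * Dz₁^[l] (fun z : ℝ => z ^ 2 / (1 + z) ^ 3) z| ≤ _
  rw [abs_mul, abs_div, abs_mul, abs_of_pos hcpos, abs_of_pos (by norm_num : (0 : ℝ) < 2)]
  have h1 := hK z hz
  have h2c : 2 / profileConst α ≤ 2 / (49 / 50) := div_le_div_of_nonneg_left (by norm_num) (by norm_num) hc49
  have hℓ := abs_nonneg (L12 (fun z θ => 3 / (1 + z) * Dθ f z θ) 0)
  calc 2 * |L12 (fun z θ => 3 / (1 + z) * Dθ f z θ) 0| / profileConst α * |Dz₁^[l] (fun z : ℝ => z ^ 2 / (1 + z) ^ 3) z|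
      = (2 / profileConst α) * (|L12 (fun z θ => 3 / (1 + z) * Dθ f z θ) 0| *
          |Dz₁^[l] (fun z : ℝ => z ^ 2 / (1 + z) ^ 3) z|) := by ring
    _ ≤ (2 / (49 / 50)) * (|L12 (fun z θ => 3 / (1 + z) * Dθ f z θ) 0| * (K * (z ^ 2 / (1 + z) ^ 3))) := by
        gcongr
    _ = 2 / (49 / 50) * K * |L12 (fun z θ => 3 / (1 + z) * Dθ f z θ) 0| * (z ^ 2 / (1 + z) ^ 3) := by ring

end Elgindi

end Literature.Analysis.FluidPDE
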